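import Literature.MathematicalPhysics.QuantumFieldTheory.ConstructiveQFTWave0Proofs
import HarnessLib

/-!
# Diagonal-plane reflection positivity FAILS on the periodic torus (gauge-boot, task L3(γ))

HONEST FRAMING (cell `pub-gaugeboot`, page 1 of every file): the venture produces certified bounds
on lattice expectations at stated coupling, gauge group, dimension and torus size; NOT a mass gap,
NOT a continuum limit, NOT a string tension; NOT Yang–Mills-summit-bearing (barriers
`FixedCouplingUltralocality`, `PerturbativeInvisibility`). This module is a small NEGATIVE result
about which positivity constraints a TORUS certificate may use; it discharges nothing else.

## Content

The loop-equation bootstrap (Kazakov–Zheng arXiv:2203.11360 §3.1, arXiv:2404.16925 §3.2, p. 10;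
Guo–Li–Yang–Zhu arXiv:2502.14421 p. 16, the `R₂` "mirror `x = z`" matrices) uses THREE families of
reflection positivity on `ℤ^D`: site planes `x_i = 0`, link planes `x_i = ½`, DIAGONAL planes
`x_i = x_j`. The tree's torus vocabulary (`GaugeConfig`, `wilsonMeasure`, `wilsonExpectation` on
`(ℤ/L)^d`, `Literature.MathematicalPhysics.QuantumFieldTheory`) carries the first two as theorems
(`wilsonExpectation_reflectionPositive_holds`, the site-RP files). This file shows that the third
does NOT transplant to the periodic torus in the closed-half-space form a certificate block needs:

* `siteDiagSwap i j` / `edgeDiagSwap i j` / `configDiagSwap i j` — the swap `θ : y ↦ y ∘ (i j)` of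
  `(ℤ/L)^d`, the induced permutation of positively oriented links `(y, k) ↦ (θy, (i j) k)` (no
  inversion: `θ(y + e_k) = θy + e_{(i j)k}`, `siteDiagSwap_shift`), and the induced involution
  `Θ` of gauge configurations, `(ΘU)(e) = U(θe)`.
* `IsDiagonalHalfObservable i j F` — `F` depends only on links with both endpoints in the closed
  half `{y : 0 ≤ (y_i - y_j) mod L ≤ L/2}`; `IsDiagonalLayerObservable i j F` — only on links
  `(y, k)`, `k ∉ {i, j}`, based in the back layer `y_i - y_j ≡ L/2` (these are half observables).
* `DiagonalReflectionPositive ρ β i j` — the torus transplant of closed-half-space diagonal RP,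
  `0 ≤ ⟨(ΘF)‾ F⟩_{Λ,β}` for bounded measurable diagonal-half observables (the exact shape of
  `wilsonExpectation_reflectionPositive` with the time reflection replaced by `Θ`).
* **`exists_diagonalLayerObservable_wilsonExpectation_neg`** — for `d ≥ 3` (pairwise distinct
  directions `i, j, m`), EVERY real `β`, every even `L ≥ 2`, every non-trivial compact Hausdorff
  `G`, every continuous `ρ`: a measurable `F`, `‖F‖ ≤ 1`, supported on the back layer, with
  `F ∘ Θ = -F` and `⟨(ΘF)‾ F⟩_{Λ,β} < 0` (real, negative).
* **`not_diagonalReflectionPositive`** — hence `¬ DiagonalReflectionPositive ρ β i j`.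

## Mechanism (pub-gaugeboot-loop/LOOP-SDP.md §3.4(i), DELTAS D1)

On `(ℤ/L)^d` the swap has TWO invariant layers of `k := y_i - y_j`: `k ≡ 0` (the mirror, fixed
pointwise) and `k ≡ L/2`, mapped to itself (`k ↦ -k`) but NOT fixed pointwise. Take a link
`e₁ = ((L/2) e_i, m)` in that layer, `e₂ = θe₁ ≠ e₁` (`exists_layer_edges`), a continuous
`g : G → [0,1]` separating two points (Urysohn), and `F(U) = g(U e₁) - g(U e₂)`. Then
`F ∘ Θ = -F`, `(ΘF)‾ F = -|F|²`, and `⟨|F|²⟩_{Λ,β} > 0` because the Boltzmann weight is bounded below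
(`|S| ≤ 2N·#plaquettes`) and product Haar measure charges the open cylinder
`{g(U e₁) < ½ < g(U e₂)}`. Neither `β ≥ 0` nor anything about the action beyond boundedness is
used: the obstruction is geometric. (No second countability of `G` is assumed.)

## What is NOT claimed

* `d = 2`: for `L ≥ 4` no link has both endpoints in the layer `k ≡ L/2`; whether closed-half-space
  diagonal RP holds on the two-dimensional even torus is left open (LOOP-SDP §3.4(ii): the
  Osterwalder–Seiler factorisation is sign-indefinite there; no proof either way known to the cell).
* Observables supported in `0 ≤ k ≤ m < L/2` (strictly inside the half): not covered (§3.4(ii)).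
* Free boxes / `ℤ^D`: there diagonal RP IS valid (KZ2024 p. 10) — task L3(β), not this file. So a
  Class-A TORUS certificate uses Gram, site-RP and link-RP blocks only (SCOPING A9, K7); diagonal
  blocks belong to the separately labelled Class-B (infinite-volume RP-state) statement, L3(α).

Sources: Kazakov–Zheng, arXiv:2203.11360 §3.1, arXiv:2404.16925 §3.2 (p. 10); Guo–Li–Yang–Zhu,
arXiv:2502.14421 p. 16; Osterwalder–Seiler, Ann. Phys. 110 (1978) 440, §2. The negative itself is
elementary and, as far as the cell's searches go, not in print as a theorem (printed remark, spin systems, no proof: periodic b.c.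
destroy diagonal RP — FILS, J. Stat. Phys. 22 (1980) 297, §3 (Model 3.1); M. Biskup, in LNM 1970 (2009) §5.5; tribunal t2 F-R1).
-/


open MeasureTheory Complex
open scoped ComplexOrder ENNReal

namespace Summit.QuantumFields.GaugeBoot

open Literature.MathematicalPhysics.QuantumFieldTheory

noncomputable section

/-! ## The diagonal swap on sites, links and configurations -/

section Swap

variable {d L : ℕ}

/-- The diagonal swap `θ = θ_{ij}` of the torus `(ℤ/L)^d`: `(θy)_k = y_{(i j) k}`, i.e. the
coordinates `i` and `j` are exchanged (the reflection in the hyperplane `y_i = y_j`; KZ2022 §2's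
third reflection family, GLYZ2025's mirror `x = z`). For `i = j` it is the identity. -/
def siteDiagSwap (i j : Fin d) (y : Site d L) : Site d L := fun k => y (Equiv.swap i j k)

/-- The induced permutation of positively oriented links: the link `y → y + e_k` is carried onto
the link `θy → θy + e_{(i j) k}`, again positively oriented (`siteDiagSwap_shift`), so no
inversion of link variables occurs (contrast `GaugeConfig.timeReflect`). -/
def edgeDiagSwap (i j : Fin d) (e : Edge d L) : Edge d L := (siteDiagSwap i j e.1, Equiv.swap i j e.2)

/-- The induced involution `Θ` of gauge configurations, `(ΘU)(e) = U(θ e)`. -/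
def configDiagSwap {G : Type*} (i j : Fin d) (U : GaugeConfig d L G) : GaugeConfig d L G :=
  fun e => U (edgeDiagSwap i j e)

/-- `θ` is an involution on sites. -/
theorem siteDiagSwap_siteDiagSwap (i j : Fin d) (y : Site d L) :
    siteDiagSwap i j (siteDiagSwap i j y) = y := by
  funext k
  simp [siteDiagSwap, Equiv.swap_apply_self]

/-- `θ(y + e_k) = θy + e_{(i j) k}`: the swap carries the positively oriented link `(y, k)` onto
the positively oriented link `(θy, (i j) k)` — the justification of `edgeDiagSwap`. -/
theorem siteDiagSwap_shift (i j : Fin d) (y : Site d L) (k : Fin d) :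
    siteDiagSwap i j (y.shift k) = (siteDiagSwap i j y).shift (Equiv.swap i j k) := by
  funext l
  simp only [siteDiagSwap, Site.shift, Pi.add_apply, Pi.single_apply, Equiv.swap_apply_eq_iff]

/-- `θ` is an involution on links. -/
theorem edgeDiagSwap_edgeDiagSwap (i j : Fin d) (e : Edge d L) :
    edgeDiagSwap i j (edgeDiagSwap i j e) = e := by
  obtain ⟨y, k⟩ := e
  simp [edgeDiagSwap, siteDiagSwap_siteDiagSwap, Equiv.swap_apply_self]

/-- `Θ` is an involution on configurations. -/
theorem configDiagSwap_configDiagSwap {G : Type*} (i j : Fin d) (U : GaugeConfig d L G) :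
    configDiagSwap i j (configDiagSwap i j U) = U :=
  funext fun e => by simp [configDiagSwap, edgeDiagSwap_edgeDiagSwap]

/-! ## Supports: the closed diagonal half and its back layer -/

/-- `F` is an observable of the CLOSED DIAGONAL HALF `Λ₊^{ij} = {y : 0 ≤ (y_i - y_j) mod L ≤ L/2}`:
it depends only on the link variables `U(e)` of links `e` with both endpoints in `Λ₊^{ij}` (the
torus transplant of the half-space `x_i ≥ x_j` of the diagonal reflection positivity on `ℤ^D`,
including both boundary layers `y_i - y_j ≡ 0` and `≡ L/2`). [shape] A parametric definition of a
proposition — NOT a fact. [folklore] -/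
def IsDiagonalHalfObservable {G α : Type*} (i j : Fin d) (F : GaugeConfig d L G → α) : Prop :=
  ∀ U V : GaugeConfig d L G,
    (∀ e : Edge d L, (e.1 i - e.1 j).val ≤ L / 2 →
      ((e.1.shift e.2) i - (e.1.shift e.2) j).val ≤ L / 2 → U e = V e) →
    F U = F V

/-- `F` is an observable of the BACK LAYER `{y : y_i - y_j ≡ L/2}` of the diagonal half: it
depends only on link variables `U(y, k)` with `k ∉ {i, j}` and `y_i - y_j ≡ L/2` (such a link
has both endpoints in the layer). [shape] A parametric definition of a proposition — NOT a fact.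
[folklore] -/
def IsDiagonalLayerObservable {G α : Type*} (i j : Fin d) (F : GaugeConfig d L G → α) : Prop :=
  ∀ U V : GaugeConfig d L G,
    (∀ e : Edge d L, e.2 ≠ i → e.2 ≠ j → (e.1 i - e.1 j).val = L / 2 → U e = V e) → F U = F V

/-- A link `(y, k)` with `k ∉ {i, j}` does not change `y_i - y_j`. -/
theorem shift_sub_shift_of_ne (y : Site d L) {i j k : Fin d} (hki : k ≠ i) (hkj : k ≠ j) :
    (y.shift k) i - (y.shift k) j = y i - y j := by simp [Site.shift, hki.symm, hkj.symm]

/-- Back-layer observables are closed-diagonal-half observables. -/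
theorem IsDiagonalLayerObservable.isDiagonalHalfObservable {G α : Type*} {i j : Fin d}
    {F : GaugeConfig d L G → α} (hF : IsDiagonalLayerObservable i j F) :
    IsDiagonalHalfObservable i j F := by
  intro U V hUV
  refine hF U V fun e hi hj he => hUV e (le_of_eq he) ?_
  rw [shift_sub_shift_of_ne e.1 hi hj, he]

/-- **The geometric heart.** For even `L ≥ 2`, `i ≠ j` and a third direction `m`, there are two
DISTINCT links `e₁ = (x₀, m)`, `e₂ = θ e₁` in the back layer `y_i - y_j ≡ L/2` that are exchanged
by `θ`: the layer is `θ`-invariant but not pointwise fixed. (`x₀ = (L/2) e_i`,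
`θ x₀ = (L/2) e_j`.) -/
theorem exists_layer_edges [NeZero L] (hL : Even L) {i j m : Fin d} (hij : i ≠ j) (hmi : m ≠ i)
    (hmj : m ≠ j) :
    ∃ e₁ e₂ : Edge d L, e₁ ≠ e₂ ∧ edgeDiagSwap i j e₁ = e₂ ∧ edgeDiagSwap i j e₂ = e₁ ∧
      e₁.2 = m ∧ e₂.2 = m ∧ (e₁.1 i - e₁.1 j).val = L / 2 ∧ (e₂.1 i - e₂.1 j).val = L / 2 := by
  have hLpos := NeZero.pos L
  obtain ⟨r, hr⟩ := hL
  set c : ZMod L := ((L / 2 : ℕ) : ZMod L) with hc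
  have hc_val : c.val = L / 2 := by
    rw [hc, ZMod.val_natCast]
    exact Nat.mod_eq_of_lt (by omega)
  have hc_ne : c ≠ 0 := by
    intro h
    rw [h, ZMod.val_zero] at hc_val
    omega
  have hc_neg : -c = c := by
    have h2 : c + c = 0 := by
      rw [hc, ← Nat.cast_add, show L / 2 + L / 2 = L by omega, ZMod.natCast_self]
    exact neg_eq_of_add_eq_zero_left h2
  have hsm : Equiv.swap i j m = m := Equiv.swap_apply_of_ne_of_ne hmi hmj
  refine ⟨(Pi.single i c, m), (siteDiagSwap i j (Pi.single i c), m), ?_, ?_, ?_, rfl, rfl, ?_, ?_⟩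
  · intro h
    have h1 := congrFun (congrArg Prod.fst h) i
    simp only [siteDiagSwap, Equiv.swap_apply_left, Pi.single_eq_same,
      Pi.single_eq_of_ne' hij] at h1
    exact hc_ne h1
  · simp [edgeDiagSwap, hsm]
  · simp [edgeDiagSwap, hsm, siteDiagSwap_siteDiagSwap]
  · simp [Pi.single_eq_of_ne' hij, hc_val]
  · simp [siteDiagSwap, Equiv.swap_apply_left, Equiv.swap_apply_right,
      Pi.single_eq_of_ne' hij, hc_neg, hc_val]

end Swap

/-! ## The Wilson expectation of a real observable; positivity of `⟨h²⟩` -/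

section Expectation

variable {d L N : ℕ} [NeZero L] {G : Type*} [Group G] [TopologicalSpace G] [IsTopologicalGroup G]
  [CompactSpace G] [MeasurableSpace G] [BorelSpace G] (ρ : G →* Matrix (Fin N) (Fin N) ℂ)

omit [MeasurableSpace G] [BorelSpace G] in
/-- `|S(U)| ≤ 2 N · #plaquettes` for a continuous representation, hence the two-sided bound
`e^{-|β|B} ≤ e^{-β S(U)} ≤ e^{|β|B}`, `B = 2N·#plaquettes`, on the Boltzmann weight. -/
theorem exp_wilsonAction_bounds (hρ : Continuous ρ) (β : ℝ) (U : GaugeConfig d L G) :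
    Real.exp (-(|β| * (2 * N * Fintype.card (Plaquette d L)))) ≤
        Real.exp (-β * wilsonAction ρ U) ∧
      Real.exp (-β * wilsonAction ρ U) ≤
        Real.exp (|β| * (2 * N * Fintype.card (Plaquette d L))) := by
  have hS : |wilsonAction ρ U| ≤ 2 * N * Fintype.card (Plaquette d L) := by
    rw [WilsonRP.wilsonAction_eq]
    have h1 : |∑ p, WilsonRP.plaqRe ρ U p| ≤ N * Fintype.card (Plaquette d L) := by
      refine (Finset.abs_sum_le_sum_abs _ _).trans ?_
      calc ∑ p, |WilsonRP.plaqRe ρ U p| ≤ ∑ _p : Plaquette d L, (N : ℝ) :=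
            Finset.sum_le_sum fun p _ => WilsonRP.abs_plaqRe_le ρ hρ U p
        _ = N * Fintype.card (Plaquette d L) := by
            rw [Finset.sum_const, Finset.card_univ, nsmul_eq_mul, mul_comm]
    have h2 : (0 : ℝ) ≤ N * Fintype.card (Plaquette d L) := by positivity
    rw [abs_le] at h1 ⊢
    constructor <;> linarith [h1.1, h1.2]
  have hb : |β * wilsonAction ρ U| ≤ |β| * (2 * N * Fintype.card (Plaquette d L)) := by
    rw [abs_mul]
    exact mul_le_mul_of_nonneg_left hS (abs_nonneg _)
  obtain ⟨h1, h2⟩ := abs_le.1 hb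
  exact ⟨Real.exp_le_exp.2 (by linarith), Real.exp_le_exp.2 (by linarith)⟩

/-- The partition function of a continuous representation is neither `0` nor `∞`. -/
theorem partitionFunction_ne_zero_ne_top (hρ : Continuous ρ) (β : ℝ) :
    partitionFunction (d := d) (L := L) ρ β ≠ 0 ∧ partitionFunction (d := d) (L := L) ρ β ≠ ⊤ := by
  set π : Measure (GaugeConfig d L G) := Measure.pi fun _ : Edge d L => haarProbability G with hπ
  have hZ : partitionFunction (d := d) (L := L) ρ β =
      ∫⁻ U, ENNReal.ofReal (Real.exp (-β * wilsonAction ρ U)) ∂π := by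
    simp only [partitionFunction, wilsonWeight, withDensity_apply _ MeasurableSet.univ,
      Measure.restrict_univ, hπ]
  have hconst (c : ℝ) : ∫⁻ _U, ENNReal.ofReal c ∂π = ENNReal.ofReal c := by simp [hπ]
  set B : ℝ := 2 * N * Fintype.card (Plaquette d L) with hB
  have hlow : ENNReal.ofReal (Real.exp (-(|β| * B))) ≤ partitionFunction (d := d) (L := L) ρ β := by
    rw [hZ, ← hconst]
    exact lintegral_mono fun U => ENNReal.ofReal_le_ofReal (exp_wilsonAction_bounds ρ hρ β U).1
  have hup : partitionFunction (d := d) (L := L) ρ β ≤ ENNReal.ofReal (Real.exp (|β| * B)) := by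
    rw [hZ, ← hconst]
    exact lintegral_mono fun U => ENNReal.ofReal_le_ofReal (exp_wilsonAction_bounds ρ hρ β U).2
  exact ⟨(lt_of_lt_of_le (ENNReal.ofReal_pos.2 (Real.exp_pos _)) hlow).ne',
    ne_top_of_le_ne_top ENNReal.ofReal_ne_top hup⟩

/-- The torus Wilson expectation of a real observable (cast to `ℂ`) is the real number
`Z⁻¹ ∫ e^{-β S(U)} f(U) ∏ dU_e`. -/
theorem wilsonExpectation_ofReal_eq (hρ : Continuous ρ) (β : ℝ) (f : GaugeConfig d L G → ℝ) :
    wilsonExpectation ρ β (fun U => (f U : ℂ)) =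
      (((partitionFunction (d := d) (L := L) ρ β)⁻¹).toReal *
        ∫ U, Real.exp (-β * wilsonAction ρ U) * f U
          ∂(Measure.pi fun _ : Edge d L => haarProbability G) : ℝ) := by
  have hdens : Measurable fun U : GaugeConfig d L G =>
      ENNReal.ofReal (Real.exp (-β * wilsonAction ρ U)) :=
    ENNReal.measurable_ofReal.comp ((WilsonRP.measurable_wilsonAction ρ hρ).const_mul (-β)).exp
  unfold wilsonExpectation wilsonMeasure
  rw [integral_smul_measure, integral_complex_ofReal]
  unfold wilsonWeight
  rw [integral_withDensity_eq_integral_toReal_smul hdens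
    (ae_of_all _ fun _ => ENNReal.ofReal_lt_top)]
  simp_rw [ENNReal.toReal_ofReal (Real.exp_nonneg _), smul_eq_mul, Complex.real_smul]
  push_cast
  ring

/-- **Strict positivity of `⟨h²⟩_{Λ,β}`** for a bounded measurable real `h` that does not vanish
on some non-empty OPEN set of configurations: the Boltzmann weight is bounded below and the
product Haar measure charges non-empty open sets. (No second countability of `G` is assumed, so
open sets need not be measurable; only monotonicity of the outer measure is used.) -/
theorem integral_exp_mul_sq_pos (hρ : Continuous ρ) (β : ℝ) {h : GaugeConfig d L G → ℝ}
    (hh : Measurable h) {C : ℝ} (hC : ∀ U, |h U| ≤ C) {O : Set (GaugeConfig d L G)}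
    (hO : IsOpen O) (hOne : O.Nonempty) (hOh : ∀ U ∈ O, h U ≠ 0) :
    0 < ((partitionFunction (d := d) (L := L) ρ β)⁻¹).toReal *
      ∫ U, Real.exp (-β * wilsonAction ρ U) * h U ^ 2
        ∂(Measure.pi fun _ : Edge d L => haarProbability G) := by
  set π : Measure (GaugeConfig d L G) := Measure.pi fun _ : Edge d L => haarProbability G with hπ
  obtain ⟨hZ0, hZtop⟩ := partitionFunction_ne_zero_ne_top (d := d) (L := L) ρ hρ β
  refine mul_pos (ENNReal.toReal_pos (ENNReal.inv_ne_zero.2 hZtop) (ENNReal.inv_ne_top.2 hZ0)) ?_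
  set f : GaugeConfig d L G → ℝ := fun U => Real.exp (-β * wilsonAction ρ U) * h U ^ 2 with hf
  have hf_nonneg : 0 ≤ f := fun U => mul_nonneg (Real.exp_nonneg _) (sq_nonneg _)
  have hf_meas : Measurable f :=
    ((WilsonRP.measurable_wilsonAction ρ hρ).const_mul (-β)).exp.mul (hh.pow_const 2)
  have hf_bound : ∀ U, ‖f U‖ ≤ Real.exp (|β| * (2 * N * Fintype.card (Plaquette d L))) * C ^ 2 :=
    fun U => by
    rw [Real.norm_eq_abs, abs_of_nonneg (hf_nonneg U)]
    refine mul_le_mul (exp_wilsonAction_bounds ρ hρ β U).2 ?_ (sq_nonneg _) (Real.exp_nonneg _)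
    rw [← sq_abs]
    exact pow_le_pow_left₀ (abs_nonneg _) (hC U) 2
  have hf_int : Integrable f π :=
    Integrable.of_bound hf_meas.aestronglyMeasurable _ (ae_of_all _ hf_bound)
  rw [integral_pos_iff_support_of_nonneg hf_nonneg hf_int]
  have hOsupp : O ⊆ Function.support f := fun U hU => by
    rw [Function.mem_support, hf]
    exact mul_ne_zero (Real.exp_pos _).ne' (pow_ne_zero 2 (hOh U hU))
  exact lt_of_lt_of_le (hO.measure_pos π hOne) (measure_mono hOsupp)

end Expectation

/-! ## The negative -/

section Negative

variable {d L N : ℕ} [NeZero L] {G : Type*} [Group G] [TopologicalSpace G] [IsTopologicalGroup G]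
  [CompactSpace G] [MeasurableSpace G] [BorelSpace G] (ρ : G →* Matrix (Fin N) (Fin N) ℂ)

/-- **The torus transplant of the closed-half-space diagonal reflection positivity** (the shape
a diagonal `R₂`-type certificate block on the torus `(ℤ/L)^d` would need; cf. the time-reflection
statement `wilsonExpectation_reflectionPositive`): for every bounded measurable observable `F`
of the closed diagonal half `{0 ≤ (y_i - y_j) mod L ≤ L/2}`,
`0 ≤ ⟨(ΘF)‾ · F⟩_{Λ,β}` (real and non-negative in `Complex.partialOrder`), `Θ = configDiagSwap i j`.
This is FALSE for `d ≥ 3` (`not_diagonalReflectionPositive`); it is recorded as a definition only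
to be negated. [shape] A parametric definition of a proposition — NOT a fact (and not true).
[folklore] -/
def DiagonalReflectionPositive (β : ℝ) (i j : Fin d) : Prop :=
  ∀ (F : GaugeConfig d L G → ℂ), Measurable F → (∃ C : ℝ, ∀ U, ‖F U‖ ≤ C) →
    IsDiagonalHalfObservable i j F →
      0 ≤ wilsonExpectation ρ β fun U => (starRingEnd ℂ) (F (configDiagSwap i j U)) * F U

/-- **L3(γ): diagonal reflection positivity fails on the even torus, at every coupling.**
Let `d ≥ 3` with pairwise distinct directions `i, j, m`, `L` even (`L ≥ 2`), `G` a non-trivial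
compact Hausdorff group, `ρ` continuous, `β ∈ ℝ` arbitrary. There is a measurable observable `F`
with `‖F‖ ≤ 1`, depending only on link variables `U(y, m)` based in the back layer
`y_i - y_j ≡ L/2`, which is ODD under the diagonal swap, `F ∘ Θ = -F`, and for which
`⟨(ΘF)‾ F⟩_{Λ,β} = -⟨|F|²⟩_{Λ,β} < 0` (a real negative number). Witness:
`F(U) = g(U(x₀, m)) - g(U(θx₀, m))` with `x₀ = (L/2) e_i` and `g : G → [0,1]` continuous
separating two points. -/
theorem exists_diagonalLayerObservable_wilsonExpectation_neg [Nontrivial G] [T2Space G]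
    (hL : Even L) (hρ : Continuous ρ) (β : ℝ) {i j m : Fin d} (hij : i ≠ j) (hmi : m ≠ i)
    (hmj : m ≠ j) :
    ∃ F : GaugeConfig d L G → ℂ, Measurable F ∧ (∀ U, ‖F U‖ ≤ 1) ∧
      IsDiagonalLayerObservable i j F ∧ (∀ U, F (configDiagSwap i j U) = -F U) ∧
      wilsonExpectation ρ β (fun U => (starRingEnd ℂ) (F (configDiagSwap i j U)) * F U) < 0 := by
  obtain ⟨e₁, e₂, hne, hsw₁, hsw₂, he₁m, he₂m, he₁L, he₂L⟩ :=
    exists_layer_edges (d := d) hL hij hmi hmj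
  obtain ⟨a, b, hab⟩ := exists_pair_ne G
  obtain ⟨g, hga, hgb, hg01⟩ := exists_continuous_zero_one_of_isClosed
    (isClosed_singleton (x := a)) (isClosed_singleton (x := b)) (Set.disjoint_singleton.2 hab)
  -- the real observable
  set h : GaugeConfig d L G → ℝ := fun U => g (U e₁) - g (U e₂) with hh
  have hh_meas : Measurable h :=
    (g.continuous.measurable.comp (measurable_pi_apply e₁)).sub
      (g.continuous.measurable.comp (measurable_pi_apply e₂))
  have hh_bound : ∀ U, |h U| ≤ 1 := fun U => by
    rw [hh, abs_sub_le_iff]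
    constructor <;> linarith [(hg01 (U e₁)).1, (hg01 (U e₁)).2, (hg01 (U e₂)).1, (hg01 (U e₂)).2]
  have hh_odd : ∀ U, h (configDiagSwap i j U) = -h U := fun U => by
    simp only [hh, configDiagSwap, hsw₁, hsw₂]
    ring
  refine ⟨fun U => (h U : ℂ), Complex.measurable_ofReal.comp hh_meas, fun U => ?_, ?_, fun U => ?_, ?_⟩
  · rw [Complex.norm_real, Real.norm_eq_abs]
    exact hh_bound U
  · intro U V hUV
    have h1 : U e₁ = V e₁ := hUV e₁ (he₁m ▸ hmi) (he₁m ▸ hmj) he₁L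
    have h2 : U e₂ = V e₂ := hUV e₂ (he₂m ▸ hmi) (he₂m ▸ hmj) he₂L
    simp only [hh, h1, h2]
  · show ((h (configDiagSwap i j U) : ℝ) : ℂ) = -((h U : ℝ) : ℂ)
    rw [hh_odd]
    push_cast
    ring
  · -- `⟨(ΘF)‾ F⟩ = -Z⁻¹ ∫ e^{-βS} h² < 0`
    have hint : (fun U => (starRingEnd ℂ) ((h (configDiagSwap i j U) : ℝ) : ℂ) * (h U : ℂ)) =
        fun U => ((-(h U ^ 2) : ℝ) : ℂ) := by
      funext U
      rw [Complex.conj_ofReal, hh_odd]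
      push_cast
      ring
    rw [hint, wilsonExpectation_ofReal_eq ρ hρ β, ← Complex.ofReal_zero, Complex.real_lt_real]
    set O : Set (GaugeConfig d L G) :=
      (fun U : GaugeConfig d L G => U e₁) ⁻¹' (g ⁻¹' Set.Iio (1 / 2 : ℝ)) ∩
        (fun U : GaugeConfig d L G => U e₂) ⁻¹' (g ⁻¹' Set.Ioi (1 / 2 : ℝ)) with hOdef
    have hO : IsOpen O :=
      ((isOpen_Iio.preimage g.continuous).preimage (continuous_apply e₁)).inter
        ((isOpen_Ioi.preimage g.continuous).preimage (continuous_apply e₂))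
    have hOne : O.Nonempty := by
      refine ⟨Function.update (fun _ => a) e₂ b, ?_, ?_⟩
      · simp only [Set.mem_preimage, Function.update_of_ne hne, hga rfl, Set.mem_Iio]; norm_num
      · simp only [Set.mem_preimage, Function.update_self, hgb rfl, Set.mem_Ioi]; norm_num
    have hOh : ∀ U ∈ O, h U ≠ 0 := by
      rintro U ⟨h1, h2⟩
      simp only [Set.mem_preimage, Set.mem_Iio, Set.mem_Ioi] at h1 h2
      show g (U e₁) - g (U e₂) ≠ 0
      exact (by linarith : g (U e₁) - g (U e₂) < 0).ne
    have hpos := integral_exp_mul_sq_pos (d := d) (L := L) ρ hρ β hh_meas hh_bound hO hOne hOh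
    have hrw : (fun U : GaugeConfig d L G => Real.exp (-β * wilsonAction ρ U) * -(h U ^ 2)) =
        fun U => -(Real.exp (-β * wilsonAction ρ U) * h U ^ 2) := funext fun U => by ring
    rw [hrw, integral_neg, mul_neg]
    linarith

/-- **L3(γ), corollary: `¬ DiagonalReflectionPositive`** on the even torus `(ℤ/L)^d`, `d ≥ 3`,
for every real `β`, every non-trivial compact Hausdorff `G`, every continuous `ρ`. Hence a
certificate valid "for every even torus `L ≥ L₀`" (shape (A)) may not contain diagonal-RP blocks
(SCOPING.md A9 / K7); they belong to the Class-B statement of task L3(α). -/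
theorem not_diagonalReflectionPositive [Nontrivial G] [T2Space G] (hL : Even L)
    (hρ : Continuous ρ) (β : ℝ) {i j m : Fin d} (hij : i ≠ j) (hmi : m ≠ i) (hmj : m ≠ j) :
    ¬ DiagonalReflectionPositive (d := d) (L := L) ρ β i j := by
  intro hRP
  obtain ⟨F, hF, hFb, hFL, -, hneg⟩ :=
    exists_diagonalLayerObservable_wilsonExpectation_neg (d := d) (L := L) ρ hL hρ β hij hmi hmj
  exact lt_irrefl _ (lt_of_le_of_lt (hRP F hF ⟨1, hFb⟩ hFL.isDiagonalHalfObservable) hneg)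

end Negative

end

end Summit.QuantumFields.GaugeBoot
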